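import Summits.HodgeConjecture.HodgeConjecture.Theorems.F0P3AntiholCohUnitaryToken       -- ★ `exists_cohUnitaryToken_of_isCot_cpt`; carries ★ `F0P3UnitaryLocOfRecord` (`clInfChoiceU`, `exists_spec_clInfChoiceU_eq`), ★ `F0P3ArchIsotypyConj` (`archIsotypy_cm_of_hol_half`), ★ `F0P3StubF1aHolHalf` (`archIsotypy_of_isHolCotangentAt`), ★ `F0P3ArchTokenSeam` (`areGKEquivalent_of_tokens`)
import Summits.HodgeConjecture.HodgeConjecture.Theorems.F0P3ArchClassTokenOfRecord       -- ★ `hasToken_of_areUnitarilyEquivalent`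
import Summits.HodgeConjecture.HodgeConjecture.Theorems.F0P3CompactTrivOfRecord          -- ★ `cmCompactFactor_rightRegular_eq_self_of_isHolOrAntihol`
import Summits.HodgeConjecture.HodgeConjecture.Theorems.R90S9SphericalClassTuple         -- ★ S9 `tupleOf`, `tupleOf_fst`, `repOf`, `classOf_repOf`, `areUnitarilyEquivalent_repOf`; carries ★ `R90S9InnerFormSec146Scope` (`IsKcSpherical`, `RepPrimeSph`, `classOfSph`), ★ `…Sec146Data` (`classOf`, `classOf_eq_classOf_iff`)
import HarnessLib

/-!
# R90-TF · S7 (Ch. 14.6-tuple, C146) · THE ARCHIMEDEAN CLASS OF RECORD IS AN INVARIANT OF THE UNITARY CLASS OF A COTANGENT `P`, and S9's components record reads it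
# ([Rogawski1990, §14.5 p. 237, §14.6 p. 244; Prop. 15.2.1 (b) p. 249]; [FlathCorvallis1979, Thm. 3]; [BorelJacquet1979, §4.6]; [Dixmier1977, §13.1.3])

Cell `hodgecm-mathlib`, crux H413 (`stmt-HodgeConjecture-24833`), route of record `HCCMUnconditional`; programme R90-TF (brief `director/R90-BRIEF.v2.md` 1f40d54518340a35),
section S7 = Rogawski §14.6 (base `R90-C146`), seat R90-C146-p01 (g2); S7 pen LH7-plan (g5) RULING S7-R22 (1) (2026-09-05T03:00:19Z, word given on the seat's probe
D-S7#13 `R90/R90-C146-p01/g2/jq77c/SGInf_BridgeProbe.v1.lean` 7799285e05d9203c, §2).  Helper file, lane `--supports stmt-HodgeConjecture-24833 --as helper`; THEOREMS ONLY (no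
definition, no instance, no notation, no `sorry`, no named-fact hypothesis); ★-only imports (no `Cruxes/…/Lines` module).

WHY.  Junction JQ-S7-7c (S7-R20∕R21∕R22) reduces S2's archimedean socket Σ∞-ι and S7's D2 to ONE S9 organ «(S-G)∞» (FILE E `R90.S7.SGInfLetter`), stated in the currency «the
archimedean class of record ★ `clInfChoiceU [J⁺] P` lies in the packet of record».  S9's §14.6 chain (★ M1 ∕ ★ `archSlot_of_contribA_guarded` ∕ ★ M2a) speaks instead of the
ARCHIMEDEAN COORDINATE of its components record, `(tupleOf π′).1 = clInfChoiceU [J⁺] (repOf π′.1)` (★ `tupleOf_fst`), read on the REPRESENTATIVE OF RECORD of the unitary class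
`π′ = classOf P`.  This file proves the letter-free bridge between the two readings for a COTANGENT `P` (bridge (m1) of the seat's census D-S7#11): the archimedean class of
record does not depend on the representative, and S9's coordinate at `classOfSph P` IS `clInfChoiceU [J⁺] P`; plus the membership transport that makes «(S-G)∞» and its
tuple-currency twin interchangeable in a later Lines edition (E ED. 2), which this ★ file cannot import.

THE MATHEMATICS (one paragraph).  A holomorphic-or-antiholomorphic cotangent discrete `P` of `U(H)` is fixed pointwise by the compact archimedean factor `K_c` (★
`cmCompactFactor_rightRegular_eq_self_of_isHolOrAntihol`), hence `K_c`-spherical in S9's scope (★ `IsKcSpherical`, [BorelJacquet1979, §4.6]).  It satisfies archimedean isotypy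
F1a (★ `archIsotypy_cm_of_hol_half` ∘ ★ `archIsotypy_of_isHolCotangentAt`) and has a coh-unitary `(𝔤,K)`-token `r` (★ `exists_cohUnitaryToken_of_isCot_cpt`, [Prop. 15.2.1 (b)]).
The representative of record `P′ := repOf (classOf P)` is unitarily equivalent to `P` (★ `classOf_eq_classOf_iff`, ★ `classOf_repOf`, ★ `areUnitarilyEquivalent_repOf`,
[Dixmier1977, §13.1.3]) and tokens travel along unitary equivalence in both directions (★ `hasToken_of_areUnitarilyEquivalent`, [FlathCorvallis1979, Thm. 3]); so both
`clInfChoiceU [J⁺] P′` and `clInfChoiceU [J⁺] P` sit in their genuine branch (★ `exists_spec_clInfChoiceU_eq`) as the classes of coh-unitary tokens `r′`, `r₀` — both tokens of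
the ONE `P` — which F1a makes `(𝔤,K)`-equivalent (★ `areGKEquivalent_of_tokens`).  Hence `clInfChoiceU [J⁺] P′ = clInfChoiceU [J⁺] P`, i.e. `(tupleOf (classOfSph P)).1 =
clInfChoiceU [J⁺] P` — in print: «`π′ ≅ π′_∞ ⊗ ⊗′ π′_v`, and `π′_∞` is an invariant of the unitary class of `π′`» [§14.5 p. 237].

WHAT IS PROVED (namespace `Summit.HodgeConjecture.HodgeConjecture.R90.S7`; frame `(L ι H T hT) hdef h2 (μ) (P) hP` = the CM frame of every S2∕S7 letter):
* `isKcSpherical_of_isCot` — a cotangent `P` is `K_c`-spherical.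
* `clInfChoiceU_repOf_classOf_eq_of_isCot` — `clInfChoiceU [J⁺] (repOf (classOf P)) = clInfChoiceU [J⁺] P`.
* `tupleOf_fst_classOfSph_eq` — `(tupleOf (classOfSph P hsph)).1 = clInfChoiceU [J⁺] P`.
* `clInfChoiceU_mem_iff_tupleOf_fst_mem` — for EVERY set `S` of archimedean classes, `clInfChoiceU [J⁺] P ∈ S ↔ (tupleOf (classOfSph P hsph)).1 ∈ S` (the letter-free transport
  that makes FILE E's `SGInfLetter` and its tuple twin a one-liner apart).
HONEST LABEL.  Letter-free plumbing over existing declarations; it PAYS NO organ («(S-G)∞» stays OPEN and S9-owned, Σ∞-ι and D2 OPEN).  HC_CM is proved only modulo the 7 printed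
citations (2 remaining named inputs: hLiu418 = stmt-HodgeConjecture-24832, h413 = stmt-HodgeConjecture-24833) until rung 0 closes; count-neutral.

## References
* [Rogawski1990] J. D. Rogawski, *Automorphic Representations of Unitary Groups in Three Variables*, Ann. of Math. Stud. 123 (1990): §14.5 p. 237 (the discrete spectrum of `G′`
  and its components); §14.6 p. 244; Prop. 15.2.1 (b) p. 249.
* [FlathCorvallis1979] D. Flath, *Decomposition of representations into tensor products*, Proc. Sympos. Pure Math. 33.1 (1979): Thm. 3 and Thm. 4.
* [BorelJacquet1979] A. Borel, H. Jacquet, *Automorphic forms and automorphic representations*, Proc. Sympos. Pure Math. 33.1 (1979): §4.6.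
* [Dixmier1977] J. Dixmier, *C*-algebras* (1977): §13.1.3 (unitary equivalence).
* [BorelWallach2000] A. Borel, N. Wallach, *Continuous Cohomology, Discrete Subgroups, and Representations of Reductive Groups*, 2nd ed. (2000): VI Thm. 4.11; VII 2.10.
-/

set_option autoImplicit false
-- the mandated namespace repeats the single-problem summit's segment (`HodgeConjecture.HodgeConjecture`)
set_option linter.dupNamespace false

noncomputable section

open NumberField IsDedekindDomain MeasureTheory
open scoped Matrix ComplexOrder

namespace Summit.HodgeConjecture.HodgeConjecture.R90.S7

open Literature.NumberTheory.Automorphic Literature.NumberTheory.Automorphic.UnitaryGroup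
open Literature.NumberTheory.Automorphic.UnitaryGroup.CotangentForms
open Literature.RepresentationTheory.BorelWallach2000
open Literature.RepresentationTheory.KonnoKonno2007 Literature.RepresentationTheory.KonnoKonno2007.RealDualPair
open Literature.RepresentationTheory.KonnoKonno2007.RealDualPair.UForm
open Summit.HodgeConjecture.HodgeConjecture.Cruxes.H413
open Summit.HodgeConjecture.HodgeConjecture.Cruxes.H413.F0P3bArchDegOneClass (archDegOneClass)
open Summit.HodgeConjecture.HodgeConjecture.Cruxes.H413.F0P3bArchDegOnePackage (IsCohUnitaryIrrep)
open Summit.HodgeConjecture.HodgeConjecture.Cruxes.H413.F0P3InnerFormClassification (HasToken)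
open Summit.HodgeConjecture.HodgeConjecture.Cruxes.H413.F0P3UnitaryLocOfRecord (clInfChoiceU exists_spec_clInfChoiceU_eq)
open Summit.HodgeConjecture.HodgeConjecture.Cruxes.H413.F0P3AntiholCohUnitaryToken (exists_cohUnitaryToken_of_isCot_cpt)
open Summit.HodgeConjecture.HodgeConjecture.Cruxes.H413.F0P3ArchIsotypyConj (archIsotypy_cm_of_hol_half)
open Summit.HodgeConjecture.HodgeConjecture.Cruxes.H413.F0P3ArchClassTokenOfRecord (hasToken_of_areUnitarilyEquivalent)
open Summit.HodgeConjecture.HodgeConjecture.Cruxes.H413.F0P3ArchTokenSeam (areGKEquivalent_of_tokens)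
open Summit.HodgeConjecture.HodgeConjecture.Cruxes.H413.F0P3CompactTrivOfRecord (cmCompactFactor_rightRegular_eq_self_of_isHolOrAntihol)
open Summit.HodgeConjecture.HodgeConjecture.R90.S9.InnerFormSec146 (IsKcSpherical RepPrimeSph classOfSph classOf repOf tupleOf tupleOf_fst classOf_repOf
  classOf_eq_classOf_iff areUnitarilyEquivalent_repOf)

section Frame

variable (L : Type) [Field L] [NumberField L] [IsCMField L] (ι : L →+* ℂ) (H : Matrix (Fin 3) (Fin 3) L) (T : GL (Fin 3) ℂ)
  (hT : (T : Matrix (Fin 3) (Fin 3) ℂ)ᴴ * H.map ι * (T : Matrix (Fin 3) (Fin 3) ℂ) = Literature.Geometry.ComplexHyperbolic.BallModel.J)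
  (hdef : ∀ τ' : L →+* ℂ, InfinitePlace.mk τ' ≠ InfinitePlace.mk ι → (H.map τ').PosDef)
  (h2 : 2 ≤ Module.finrank ℚ ↥(maximalRealSubfield L))
  (μ : Measure (adelicGroupData (↥(maximalRealSubfield L)) L (IsCMField.complexConj L) 3 H).automorphicQuotient)
  [(adelicGroupData (↥(maximalRealSubfield L)) L (IsCMField.complexConj L) 3 H).IsAutomorphicMeasure μ]
  (P : DiscreteAutomorphicRep (adelicGroupData (↥(maximalRealSubfield L)) L (IsCMField.complexConj L) 3 H) μ)
  (hP : P.IsHolCotangentAt (cmArchSection L ι H T hT) (cmCompactFactor L ι H T hT) ∨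
    P.IsAntiholCotangentAt (cmArchSection L ι H T hT) (cmCompactFactor L ι H T hT))

include hP in
/-- **A cotangent `P` is `K_c`-spherical**: the compact archimedean factor `K_c = cmCompactFactor L ι H T hT` fixes a holomorphic-or-antiholomorphic cotangent discrete `P` pointwise
(★ `cmCompactFactor_rightRegular_eq_self_of_isHolOrAntihol`), which is S9's scope predicate ★ `IsKcSpherical` on the nose. [cite: Rogawski1990, §14.6 p. 244] [cite: BorelJacquet1979, §4.6] -/
theorem isKcSpherical_of_isCot : IsKcSpherical L ι H T hT μ P :=
  fun k hk v hv => cmCompactFactor_rightRegular_eq_self_of_isHolOrAntihol L ι H T hT P hP k hk ⟨v, hv⟩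

include hdef h2 hP in
/-- **THE ARCHIMEDEAN CLASS OF RECORD IS THE SAME ON `P` AND ON ITS REPRESENTATIVE OF RECORD `repOf (classOf P)`** (cotangent `P`; no «ARCH» letter): `P` has F1a (★
`archIsotypy_cm_of_hol_half` ∘ ★ `archIsotypy_of_isHolCotangentAt`) and a coh-unitary token `r` (★ `exists_cohUnitaryToken_of_isCot_cpt`); `P ≃ repOf (classOf P)` unitarily (★
`classOf_eq_classOf_iff`, ★ `classOf_repOf`, ★ `areUnitarilyEquivalent_repOf`); tokens travel both ways (★ `hasToken_of_areUnitarilyEquivalent`), so both `clInfChoiceU` sit in their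
genuine branch (★ `exists_spec_clInfChoiceU_eq`) with tokens `r′`, `r₀` of the ONE `P`, which F1a makes `(𝔤,K)`-equivalent (★ `areGKEquivalent_of_tokens`).  In print: `π′_∞` is an
invariant of the unitary class of `π′`. [cite: Rogawski1990, §14.5 p. 237; Prop. 15.2.1 (b) p. 249] [cite: FlathCorvallis1979, Thm. 3] [cite: Dixmier1977, §13.1.3] [cite: BorelWallach2000, VI Thm. 4.11; VII 2.10] -/
theorem clInfChoiceU_repOf_classOf_eq_of_isCot :
    clInfChoiceU L H ι T hT μ (archDegOneClass 1 (Or.inl rfl)) (repOf L H μ (classOf L H μ P)) =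
      clInfChoiceU L H ι T hT μ (archDegOneClass 1 (Or.inl rfl)) P := by
  have hF1a : P.ArchIsotypy (uFormGroup (Fin 2) (Fin 1)) (cmArchSectionUForm L ι H T hT) :=
    archIsotypy_cm_of_hol_half L ι H T hT μ (fun P' hP' => F0P3StubF1aHolHalf.archIsotypy_of_isHolCotangentAt ι T hT hdef h2 μ P' hP') P hP
  obtain ⟨r, hr, hru⟩ := exists_cohUnitaryToken_of_isCot_cpt L H ι T hT μ hdef h2 P hP
  have hPP' : ContRepresentation.AreUnitarilyEquivalent P.space.toContRep (repOf L H μ (classOf L H μ P)).space.toContRep :=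
    (classOf_eq_classOf_iff L H μ _ _).1 (classOf_repOf L H μ (classOf L H μ P)).symm
  have hP'P : ContRepresentation.AreUnitarilyEquivalent (repOf L H μ (classOf L H μ P)).space.toContRep P.space.toContRep :=
    areUnitarilyEquivalent_repOf L H μ (classOf L H μ P) P rfl
  obtain ⟨r', hr', -, hreq'⟩ := exists_spec_clInfChoiceU_eq L H ι T hT μ (archDegOneClass 1 (Or.inl rfl)) (repOf L H μ (classOf L H μ P))
    ⟨r, hasToken_of_areUnitarilyEquivalent L H ι T hT μ hPP' hr, hru⟩
  obtain ⟨r₀, hr₀, -, hreq₀⟩ := exists_spec_clInfChoiceU_eq L H ι T hT μ (archDegOneClass 1 (Or.inl rfl)) P ⟨r, hr, hru⟩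
  rw [hreq', hreq₀, GKIrrClass.mk_eq_mk_iff]
  obtain ⟨T₁, hT₁K, hT₁𝔤, hT₁⟩ := hasToken_of_areUnitarilyEquivalent L H ι T hT μ hP'P hr'
  obtain ⟨T₂, hT₂K, hT₂𝔤, hT₂⟩ := hr₀
  exact areGKEquivalent_of_tokens ι T hT P hF1a r'.isIrreducible T₁ hT₁K hT₁𝔤 hT₁ r₀.isIrreducible T₂ hT₂K hT₂𝔤 hT₂

include hdef h2 hP in
/-- **S9's ARCHIMEDEAN COORDINATE AT THE CLASS OF A COTANGENT `P` IS `clInfChoiceU [J⁺] P`**: `(tupleOf (classOfSph P hsph)).1 = clInfChoiceU [J⁺] (repOf (classOf P))` by ★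
`tupleOf_fst` (definitional), and the representative does not matter by `clInfChoiceU_repOf_classOf_eq_of_isCot`. [cite: Rogawski1990, §14.5 p. 237; §14.6 p. 244] [cite: FlathCorvallis1979, Thm. 3] -/
theorem tupleOf_fst_classOfSph_eq (hsph : IsKcSpherical L ι H T hT μ P) :
    (tupleOf L ι H T hT μ (classOfSph L ι H T hT μ P hsph)).1 = clInfChoiceU L H ι T hT μ (archDegOneClass 1 (Or.inl rfl)) P := by
  rw [tupleOf_fst]
  exact clInfChoiceU_repOf_classOf_eq_of_isCot L ι H T hT hdef h2 μ P hP

include hdef h2 hP in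
/-- **LETTER-FREE MEMBERSHIP TRANSPORT**: for EVERY set `S` of archimedean `(𝔤,K)`-classes of `U(2,1)`, «the archimedean class of record of the cotangent `P` lies in `S`» iff «the
archimedean coordinate of S9's components record at `classOfSph P hsph` lies in `S`».  (With `S := (archPacketOfRecord ι μω jInfOfRecord dsInfOfRecord ξ).members` this is the one-liner
between FILE E's organ «(S-G)∞» `R90.S7.SGInfLetter` and its tuple-currency twin — E ED. 2; a ★ file imports no Lines letter.) [cite: Rogawski1990, §14.5 p. 237; §14.6 p. 244] -/
theorem clInfChoiceU_mem_iff_tupleOf_fst_mem (hsph : IsKcSpherical L ι H T hT μ P) (S : Set (GKIrrClass (uFormGroup (Fin 2) (Fin 1)))) :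
    clInfChoiceU L H ι T hT μ (archDegOneClass 1 (Or.inl rfl)) P ∈ S ↔ (tupleOf L ι H T hT μ (classOfSph L ι H T hT μ P hsph)).1 ∈ S := by
  rw [tupleOf_fst_classOfSph_eq L ι H T hT hdef h2 μ P hP hsph]

end Frame

end Summit.HodgeConjecture.HodgeConjecture.R90.S7

end
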